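import Literature.Probability.LatticeModels.FKIsingRSWTwoPoint
import Literature.Probability.LatticeModels.FKIsingHalfPlaneArm
import HarnessLib

/-!
# RSW for the critical FK-Ising model from the ball version of DCHN's Lemma 15

Topic `Literature/Probability/LatticeModels`; assembly step of the discharge programme for the
named fact `fkIsing_rsw` (Duminil-Copin–Hongler–Nolin 2011, Thm. 1 / Duminil-Copin–Smirnov 2012,
Thm. 3.16). `FKIsingRSWTwoPoint.fkIsing_rsw_of_halfPlaneArmBounds` reduces `fkIsing_rsw` to the two
half-plane one-arm bounds of DCHN's Lemma 15 in the three-wired rectangle `[0, N] × [0, 2N]`: the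
point estimate `(hA)` `φ((0, N) ↔ wired sides) ≤ C_A/√N` and the ball estimate `(hB)`
`φ(B_k((0, N)) ↔ wired sides) ≤ C_B ((k+1)/N)^a` for some `a > 0`. The point estimate is proved in
`FKIsingHalfPlaneArm.lean` (`LatticeDobrushin.fkIsing_threeArm_le`, with `C_A = 2`; its
`rectThreeWired`, `rectCentre` are definitionally `threeWired`, `threeBoxCentre`), so that
**`fkIsing_rsw_of_ballArmBound`**: `fkIsing_rsw` follows from `(hB)` alone. `(hB)` is DCHN's
Lemma 15 for balls (Duminil-Copin 2013, Lemma 10.7), whose printed proof explores the interface up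
to the hitting time of the ball and evaluates the observable in the random slit domain; it is not
yet in the tree. Everything here is proved; no named fact is introduced.

## References

* H. Duminil-Copin, C. Hongler, P. Nolin, *Connection probabilities and RSW-type bounds for the
  two-dimensional FK Ising model*, Comm. Pure Appl. Math. 64 (2011) 1165–1198 (arXiv:0912.4253),
  §4, Proposition 14 and Lemma 15 — bib key `DuminilCopinHonglerNolin2011`.
* H. Duminil-Copin, S. Smirnov, *Conformal invariance of lattice models*, Clay Math. Proc. 15
  (2012), Theorem 3.16 — bib key `DuminilCopinSmirnov2012Clay`.
-/

noncomputable section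

namespace Literature.Probability.LatticeModels

open Percolation

/-- **RSW for the critical FK-Ising model from the ball version of DCHN's Lemma 15 alone.** With
the point estimate `(hA)` proved (`LatticeDobrushin.fkIsing_threeArm_le`), the RSW lower bound
`fkIsing_rsw` (free boundary conditions, rectangles `[0, 4n] × [0, n]`) follows from the strong
half-plane one-arm bound for balls with any positive exponent: for some `C_B` and `a > 0`, for all
`N ≥ 1` and `k`, `φ^{3 wired}_{[0,N]×[0,2N]}(B_k((0,N)) ↔ wired sides) ≤ C_B ((k+1)/N)^a`.
[cite: DuminilCopinHonglerNolin2011, §4, Proposition 14 and Lemma 15] -/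
theorem fkIsing_rsw_of_ballArmBound
    (hB : ∃ C_B a : ℝ, 0 < a ∧ ∀ N : ℕ, 1 ≤ N → ∀ k : ℕ,
      (fkIsingFiniteMeasure (rectangle N (2 * N)) (threeWired N)).real (threeBallArm N k) ≤
        C_B * (((k : ℝ) + 1) / N) ^ a) :
    fkIsing_rsw :=
  fkIsing_rsw_of_halfPlaneArmBounds ⟨2, fun N hN => LatticeDobrushin.fkIsing_threeArm_le N hN⟩ hB

end Literature.Probability.LatticeModels
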